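import Literature.MathematicalPhysics.QuantumFieldTheory.Balaban1983to89.Node00.MultiScaleFibreChartCurvatureUniform

/-!
# NODE 00 — THE CHART-CURVATURE CONSTANT, GAUGE-FREE, IN COMPACT-UNIFORM FORM: `‖D²Ψ(0)(w,w)‖ ≤ M₂·‖w‖²` with ONE `M₂` for all backgrounds `U₀` in a COMPACT set of GUARDED
# configurations (no near-flatness), all fibre data `W`, all determining sets of levels `≤ k`

[Balaban1985Variational] = «[15]», Sect. C (44)–(48) p. 285, (81)–(83) p. 290; [Balaban1989LargeFieldII] = «[LF-II]», (1.12) p. 359, p. 357; [Balaban1987RG1] (0.4) p. 253, (0.21) p. 256;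
[Balaban1988Convergent] = «[III]», (2.10)–(2.12) p. 256.  Cell `pub-ymgap`, HUMAN RULING D-0062 ∕ D-0149, width seat `pub-ymgap-dag-n12-w4` generation 5 (N12 = [B15]; the lane owner's
(b-direct) launch, item «(P5) `hM₂` gauge-free: uniform C² bound of `msChart` over the compact configuration space ∕ `AveragingSmooth`», dag-n12-c g20 WORD-5, 2026-08-28).  `--kind proof
--supports stmt-QuantumFields-27364` (K1⁹; count-neutral helper).  NEW leaf; CONSUMED BY NAME: this seat's `Node00.MultiScaleFibreChartCurvatureUniform` (p615328: the generic compact-parameter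
bound `exists_sq_bound_on_compact_of_contDiffAt_two`, the joint smoothness of the chart model `contDiffAt_chartModel`, the identification `eventually_msChart_apply_eq_chartModel`,
`fderiv_fderiv_apply_pi`, `fderiv_fderiv_congr_of_eventuallyEq`), p610492's regularity binders, dag-n12-w1's `B15Prop1DatumCoordinates.eventually_polydisc` and
`B15AveragingHolomorphic.coeField_iter_eq_iterMh`.

WHY.  p615328 produced ONE `M₂` per height over the sup-norm BALL `‖↑U₀ − 1‖ ≤ ρ″` around the flat configuration — a NEAR-FLATNESS letter, which the direct road of N12 cannot supply for
ring-shaped regions (π₁ obstruction, dag-n12-w1 p645205).  The same continuity-and-compactness argument runs over ANY compact set of GUARDED configurations: the `(j,c)`-model is jointly `C^∞`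
at `(↑U₀, 0)` whenever `U₀` is guarded below `k` (the polydisc condition is dag-n12-w1's `eventually_polydisc` at the point itself; the `log`-argument `(M_h^j ↑U₀ c)*·M_h^j ↑U₀ c` is
EXACTLY `1` because the guarded averages are unitary), so §1 of p615328 bounds the second derivatives uniformly on `↑K` for every compact `K` inside the guard.  Compactness is DISPLAYED as a
binder (the consumer takes e.g. the closed small-plaquette guard, compact in `SU(N)^{bonds}` — dag-n12-c's `B15Prop1ClosedGuardUniformRadius.isCompact_setOf_plaqLeOn`).

CONTENTS (namespace `…Node00`; theorems only — no `def`, no `instance`, no `notation`, no `sorry`).  §1 `continuous_coeField_SU` (the matrix field of a configuration depends continuously on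
it), `star_iterMh_coeField_mul_self` (under the guard `(M_h^j ↑U c)*·M_h^j ↑U c = 1`), ★ `contDiffAt_chartModel_of_smallBelow` (the model is jointly `C^∞` at `(↑U₀,0)` for every GUARDED
`U₀` — no near-flatness).  §2 ★★★ `exists_chartCurvature_sq_bound_on_compact` — for every compact `K ⊆ {U₀ | SmallBelow k U₀}`: ONE `M₂ ≥ 0` with `‖D²Ψ(0)(w,w)‖ ≤ M₂‖w‖²` for all `𝐁`,
`W`, `U₀ ∈ K` on the fibre of `W`, all `w` (`Ψ := msChart F N K k 𝐁 W U₀`).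

HONEST FRAMING ∕ LOCATED: constants by compactness of a finite 𝕋⁴ (they depend on `F.P K`, `k` and the compact `K`, NOT on the background inside `K`, the datum or the determining set);
print's VOLUME-uniform `O(1)` curvature ([15] Sect. C (48), Sect. G) is NOT claimed.  Nothing of Bałaban's asserted; N12 NOT discharged; K1⁹ NOT closed; counts unmoved (5∕27); one finite 𝕋⁴
programme at fixed ε — R4 closes the conditional rung `BalabanLadder.UV` only; NOT continuum ∕ ℝ⁴ ∕ OS ∕ mass gap ∕ Clay.
-/

noncomputable section

namespace Literature.MathematicalPhysics.QuantumFieldTheory.Balaban1983to89.Node00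

open Filter Topology Metric
open T4Continuum (T4Family)
open B15DeterminingSets
open T4AdjointCovarianceUnitary (lieSU)
open MatrixLog (mlog analyticAt_mlog)
open B15AveragingHolomorphic (iterMh loopMh iterMh_coeField_eq_iterM coeField_iter_eq_iterMh)
open B15AveragingAnalytic (contDiffAt_iterMh_of_polydisc)
open B15Prop1DatumCoordinates (eventually_polydisc)
open BlockAveraging (blockAvg Idx)
open ExpMeanLog (expMeanLogSU)
open scoped Matrix.Norms.L2Operator BigOperators

/-! ## §1  The model is jointly smooth at every GUARDED background -/

section Guarded

variable {F : T4Family} {N : ℕ} [NeZero N] {K : ℕ}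

omit [NeZero N] in
/-- The matrix field `↑U` of a configuration `U : bonds → SU(N)` depends continuously on `U` (product of subtype inclusions). [cite: Balaban1987RG1, (0.1) p.251 (bookkeeping)] -/
theorem continuous_coeField_SU {P : Params} {j : ℕ} : Continuous (coeField : GaugeField P j (SU N) → PBond P j → Matrix (Fin N) (Fin N) ℂ) :=
  continuous_pi fun b => continuous_subtype_val.comp (continuous_apply b)

/-- Under the guard below `k`, the holomorphic iterate at `↑U` is the matrix field of the guarded average, hence UNITARY: `(M_h^j ↑U c)* · M_h^j ↑U c = 1` for `j ≤ k`.
[cite: Balaban1987RG1, (0.4) p.253, (0.21) p.256] -/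
theorem star_iterMh_coeField_mul_self {k : ℕ} {U : GaugeField (F.P K) 0 (SU N)} (hsb : SmallBelow (avOfRecord F N K) k U) {j : ℕ} (hj : j ≤ k) (c : PBond (F.P K) j) :
    star (iterMh j (coeField U) c) * iterMh j (coeField U) c = 1 := by
  have h : iterMh j (coeField U) = coeField (Averaging.iter (avOfRecord F N K) j U) := (coeField_iter_eq_iterMh j (hsb.mono hj)).symm
  rw [h, coeField_apply]
  exact Matrix.mem_unitaryGroup_iff'.mp (Averaging.iter (avOfRecord F N K) j U c).2.1

/-- ★ **THE CHART MODEL IS JOINTLY `C^∞` AT EVERY GUARDED BACKGROUND** — p615328's `contDiffAt_chartModel` with its two hypotheses discharged from the guard alone: the polydisc condition at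
`↑U₀` itself (dag-n12-w1's `eventually_polydisc`) and the `log`-argument equal to `1` (`star_iterMh_coeField_mul_self`).  No near-flatness. [cite: Balaban1987RG1, (0.4) p.253; Balaban1985Variational, Sect. C p.285] -/
theorem contDiffAt_chartModel_of_smallBelow {k : ℕ} {U : GaugeField (F.P K) 0 (SU N)} (hsb : SmallBelow (avOfRecord F N K) k U) {j : ℕ} (hj : j ≤ k) (c : PBond (F.P K) j) :
    ContDiffAt ℝ ⊤ (Function.uncurry fun (V : PBond (F.P K) 0 → Matrix (Fin N) (Fin N) ℂ) (X : PBond (F.P K) 0 → lieSU (Fin N)) =>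
      suProj N (mlog (star (iterMh j V c) * iterMh j (fun b => V b * NormedSpace.exp ((X b : lieSU (Fin N)) : Matrix (Fin N) (Fin N) ℂ)) c)))
      (coeField U, 0) := by
  have hpoly : ∀ j', j' < j → ∀ (c' : PBond (F.P K) (j' + 1)) (i : Idx (F.P K)), ‖loopMh (iterMh j' (coeField U)) c' i - 1‖ < 1 :=
    fun j' hj' c' i => (eventually_polydisc hsb).self_of_nhds j' (lt_of_lt_of_le hj' hj) c' i
  have hlog : ‖star (iterMh j (coeField U) c) * iterMh j (coeField U) c - 1‖ < 1 := by
    rw [star_iterMh_coeField_mul_self hsb hj c, sub_self, norm_zero]; exact one_pos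
  exact contDiffAt_chartModel c hpoly hlog

end Guarded

/-! ## §2  One chart-curvature constant per compact set of guarded backgrounds -/

section Compact

variable {F : T4Family} {N : ℕ} [NeZero N] {K : ℕ}

/-- ★★★ **THE CHART-CURVATURE CONSTANT, GAUGE-FREE, COMPACT-UNIFORM**: for every compact set `K` of configurations GUARDED below `k` there is `M₂ ≥ 0` such that for EVERY determining set `𝐁`,
EVERY multi-scale datum `W` and EVERY `U₀ ∈ K` on the fibre of `W` (`M˙(U₀) = W` on `𝐁`): `‖D²Ψ(0)(w,w)‖ ≤ M₂·‖w‖²` for `Ψ := msChart F N K k 𝐁 W U₀` and all directions `w` — p615328 §1 on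
the compact `↑K` of matrix fields for the finite family of component models (§1: each is `C²` at `(↑U₀, 0)` from the guard alone), p615328 §2's identification of the chart with the model.
No near-flatness letter; compactness displayed as the binder `hK`. LOCATED: `M₂` depends on `F.P K`, `k`, `K`, NOT print's volume-uniform `O(1)`.
[cite: Balaban1985Variational, Sect. C (44)–(48) p.285, (81)–(83) p.290; Balaban1989LargeFieldII, (1.12) p.359; Balaban1988Convergent, (2.10)–(2.12) p.256] -/
theorem exists_chartCurvature_sq_bound_on_compact (k : ℕ) {Kset : Set (GaugeField (F.P K) 0 (SU N))} (hK : IsCompact Kset)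
    (hguard : ∀ U ∈ Kset, SmallBelow (avOfRecord F N K) k U) :
    ∃ M₂ : ℝ, 0 ≤ M₂ ∧
      ∀ (𝔹 : DetSet (F.P K)) (W : MSField (F.P K) (SU N)) (U₀ : GaugeField (F.P K) 0 (SU N)),
        U₀ ∈ Kset → AgreeOn 𝔹 (avgFamily (avOfRecord F N K) U₀) W →
        ∀ w : PBond (F.P K) 0 → lieSU (Fin N), ‖fderiv ℝ (fderiv ℝ (msChart F N K k 𝔹 W U₀)) 0 w w‖ ≤ M₂ * ‖w‖ ^ 2 := by
  let f : (PBond (F.P K) 0 → Matrix (Fin N) (Fin N) ℂ) → (PBond (F.P K) 0 → lieSU (Fin N)) →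
      (Σ j : Fin (k + 1), PBond (F.P K) j) → lieSU (Fin N) := fun V X s =>
    suProj N (mlog (star (iterMh (s.1 : ℕ) V s.2) * iterMh (s.1 : ℕ) (fun b => V b * NormedSpace.exp ((X b : lieSU (Fin N)) : Matrix (Fin N) (Fin N) ℂ)) s.2))
  have hS : IsCompact (coeField '' Kset : Set (PBond (F.P K) 0 → Matrix (Fin N) (Fin N) ℂ)) := hK.image continuous_coeField_SU
  have hf : ∀ a ∈ (coeField '' Kset : Set (PBond (F.P K) 0 → Matrix (Fin N) (Fin N) ℂ)), ContDiffAt ℝ 2 (Function.uncurry f) (a, 0) := by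
    rintro a ⟨U, hU, rfl⟩
    refine contDiffAt_pi.2 fun s => ?_
    exact (contDiffAt_chartModel_of_smallBelow (hguard U hU) (Nat.lt_succ_iff.1 s.1.2) s.2).of_le le_top
  obtain ⟨C, hC, hbound⟩ := exists_sq_bound_on_compact_of_contDiffAt_two f hS hf
  refine ⟨C, hC, fun 𝔹 W U₀ hU₀ hU w => ?_⟩
  have hsb : SmallBelow (avOfRecord F N K) k U₀ := hguard U₀ hU₀
  have hmem : coeField U₀ ∈ (coeField '' Kset : Set (PBond (F.P K) 0 → Matrix (Fin N) (Fin N) ℂ)) := ⟨U₀, hU₀, rfl⟩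
  have hfa : ContDiffAt ℝ 2 (f (coeField U₀)) 0 := by
    have h := hf _ hmem
    exact h.comp 0 (contDiffAt_const.prodMk contDiffAt_id)
  have hfa_d : ∀ᶠ X in 𝓝 (0 : PBond (F.P K) 0 → lieSU (Fin N)), DifferentiableAt ℝ (f (coeField U₀)) X :=
    (hfa.eventually (by simp)).mono fun X hX => hX.differentiableAt (by norm_num)
  have hfa_d2 : DifferentiableAt ℝ (fderiv ℝ (f (coeField U₀))) 0 :=
    ((hfa.fderiv_right (m := 1) (by norm_num)).differentiableAt (by norm_num))
  refine (pi_norm_le_iff_of_nonneg (by positivity)).2 fun i => ?_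
  set s : Σ j : Fin (k + 1), PBond (F.P K) j := ⟨((constrEnum 𝔹 k).symm i).1, ((constrEnum 𝔹 k).symm i).2.1⟩ with hs
  have h1 : fderiv ℝ (fderiv ℝ (msChart F N K k 𝔹 W U₀)) 0 w w i = fderiv ℝ (fderiv ℝ (fun X => msChart F N K k 𝔹 W U₀ X i)) 0 w w :=
    fderiv_fderiv_apply_pi (eventually_differentiableAt_msChart hU hsb) (hasFDerivAt_fderiv_msChart hU hsb).differentiableAt i w w
  have h2 : fderiv ℝ (fderiv ℝ (fun X => msChart F N K k 𝔹 W U₀ X i)) 0 = fderiv ℝ (fderiv ℝ (fun X => f (coeField U₀) X s)) 0 :=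
    fderiv_fderiv_congr_of_eventuallyEq (eventually_msChart_apply_eq_chartModel hU hsb i)
  have h3 : fderiv ℝ (fderiv ℝ (fun X => f (coeField U₀) X s)) 0 w w = fderiv ℝ (fderiv ℝ (f (coeField U₀))) 0 w w s :=
    (fderiv_fderiv_apply_pi hfa_d hfa_d2 s w w).symm
  rw [h1, h2, h3]
  exact (norm_le_pi_norm _ s).trans (hbound _ hmem w)

end Compact

end Literature.MathematicalPhysics.QuantumFieldTheory.Balaban1983to89.Node00

end
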